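import Summits.ABC.IUTFork.Joshi.InitialThetaDataJoshi
import Literature.IUT.HodgeTheaters.InitialThetaDataConditions
import HarnessLib

/-!
# [J-III] §3.5 / [J-IV] Thm. 5.7.1 (conclusion): Joshi's Initial Theta Data EXISTS — constructed outright from the arithmetic of the point, no `π₁`-geometric interface

Record file (D-0012) of the abc-iut cell, block E «type Joshi's construction, test vs S» (rung LADDER-ABC:A2.E; seat
abc-iut-E-t6, sequel of slot T-06 = `Joshi/InitialThetaDataJoshi.lean` p428841; E5 bridge offered to E-plan-2 / E-t28,
STATUS «AVAILABLE E-t6 … O1»). TAKES NO SIDE on [IUTchIII] Cor. 3.12, on the claims of K. Joshi, or on S. Mochizuki's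
reports on them; typed ≠ proved; typed AS A CANDIDATE ≠ endorsed. Sources: K. Joshi, arXiv:2401.13508v4 = [J-III], §3.5
p.29 l.37–p.30 l.11 («the existence of Initial Theta Data [Joshi, 2024a, Theorem 5.7.1] is a global assertion … cannot be
proved by p-adic local means»); arXiv:2403.10430v2 = [J-IV], Thm. 5.7.1 p.53 l.31–45 (conclusion: «`C_λ` satisfies Initial
Theta Data [Joshi, 2024c, §3.1, §3.3] … with the prime `ℓ`»); S. Mochizuki, [IUTchIV] Cor. 2.2 (ii), proof (P1)–(P7) p.46.

WHAT IS PROVED (kernel; inputs = the tree's LANDED [IUTchIV] Cor. 2.2 (P7) machinery of abc-iut-L5-t7 and -L5-t12,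
`Literature.IUT.HodgeTheaters.InitialThetaDataArith` / `…Conditions`, and E-t6's structure; no new `Prop` fact):

* `InitialThetaData.ofArithInput` — the tree's ARITHMETIC input `ArithInput E l` of [IUTchI] Def. 3.1 ((a) `√−1 ∈ F`,
  (b) `E_F[30]` `F`-rational, `F/F_mod` Galois of degree prime to `l`, …, (c) `l ≥ 5` prime, `SL₂ ⊆ Im ρ̄_{E,l}`) YIELDS
  Joshi's data `ATS3.InitialThetaData F K F̄ E_F l` with `K := F(E_F[l])` (the tree's `TorsionField`, whose `range_iff` is
  the THEOREM `TorsionField.range_iff`), `F̄ := AlgebraicClosure F`, `V := VSection` (a section of `V(K) ↠ V_mod`,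
  `VSection_bijOn`). Contrast: the Mochizuki-side constructor `InitialThetaData.ofArith` must ALSO be handed the
  `π₁`-geometric interface of [IUTchI] Def. 3.1 (d) (e) (f) (`ThetaGeometry`, `BadPlacePredicates`, the bad-place type/cusp
  hypotheses) — «constructed by campaign L, not here» — precisely the clauses Joshi's §3.1/§3.3 OMITS (E-t6's dictionary
  note in p428841). So:
* **`InitialThetaData.nonempty_at`** — for a point `λ` of the `λ`-line minimally presented in `U_P` and a prime `l ≥ 7`
  with (P2), (P5) and no `l`-cyclic subgroup scheme ((P4)), Joshi's Initial Theta Data for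
  `(F, C) = (F_mod(√−1, W[30]), W ⊗ F)` (the tree's `FTheta λ`, `ETheta λ`) EXIST — UNCONDITIONALLY (the tree's
  `arithInputAt`); and
* **`InitialThetaData.exists_HK_nonempty`** — on a compactly bounded `K_V`, above a height threshold `H_K` the (P4) input is
  automatic (the tree's `exists_HK_not_admitsLCyclic`): for `λ ∈ K_V ∩ U_P`, `l ≥ 7` prime with (P2), (P5),
  `log(q^∀(λ)) > H_K` ⟹ Joshi's data exist. This is the conclusion of [J-IV] Thm. 5.7.1 in the reading «there EXIST `L'`,
  `L̄` and a structure `ATS3.InitialThetaData L L' L̄ C ℓ`» for the theta field `FTheta λ` (E-t28's `HasInitialThetaData`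
  quantifies over EVERY theta field `F ≅ FTheta λ` of `λ`; the transport along such `ℚ(λ)`-isomorphisms is not done here —
  flagged to E-t28 / slot T-28).

Dictionary: [J-IV] Thm. 5.7.1 ↔ [IUTchIV] Cor. 2.2 (ii); Joshi's (P2)/(P5)/(P6) = Lem. 5.8.7 (2) / Lem. 5.8.9 / Lem. 5.8.11 =
the tree's `Cor22.CondP2` / `Cor22.CondP5` / `imageContainsSL2_of_not_admitsLCyclic`. [claim: Joshi2024ATS3, status: disputed]
[claim: Joshi2024ATS4, status: disputed] [claim: Mochizuki2012, status: disputed]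
-/

noncomputable section

open scoped Classical
open NumberField IsDedekindDomain
open Literature.IUT.HodgeTheaters hiding InitialThetaData
open Literature.NumberTheory.DiophantineGeometry.GenEll Literature.IUT.LogVolume

universe u

namespace Summit.ABC.IUTFork.Joshi.ATS3.InitialThetaData

/-! ## Joshi's data from the tree's arithmetic input of [IUTchI] Def. 3.1 -/

section OfArith

variable {F : Type u} [Field F] [NumberField F] (E : WeierstrassCurve F) [E.IsElliptic] (l : ℕ)

/-- **Joshi's Initial Theta Data from the ARITHMETIC clauses of [IUTchI] Def. 3.1** (the tree's `ArithInput E l`; cf. the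
Mochizuki-side `Literature.IUT.HodgeTheaters.InitialThetaData.ofArith`, which needs in addition the `π₁`-geometric interface of
(d) (e) (f)): `L := F`, `L' := K = F(E_F[l])` (`TorsionField E l`; (13) is the THEOREM `TorsionField.range_iff`),
`L̄ := AlgebraicClosure F`, `C := E_F`, `ℓ := l`; (1) from (a) `√−1 ∈ F`; (9) (10) (11) (12) from (b) (c); (14) `V :=` the
chosen section `VSection` (`VSection_bijOn`). A DEFINITION (construction); nothing of [J-III] is asserted.
[claim: Joshi2024ATS3, status: disputed] [claim: Mochizuki2012, status: disputed] -/
def ofArithInput (A : ArithInput E l) [NeZero l] :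
    InitialThetaData F (TorsionField E l) (AlgebraicClosure F) E l where
  isTotallyComplex := by
    obtain ⟨i, hi⟩ := A.sqrt_neg_one_mem
    exact isTotallyComplex_of_sq_eq_neg_one hi
  isGalois_fieldOfModuli := A.isGalois_fieldOfModuli
  torsion_six_rational := A.torsion_six_rational
  prime := A.l_prime
  five_le := A.five_le_l
  not_dvd_finrank := fun h => A.l_prime.ne_one (Nat.Coprime.eq_one_of_dvd A.finrank_coprime.symm h)
  imageContainsSL2 := A.imageContainsSL2
  range_iff := TorsionField.range_iff E l
  V := VSection E (TorsionField E l)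
  V_bijOn := VSection_bijOn E (TorsionField E l)

/-- The chosen valuations of the constructed datum are the tree's section `VSection`. [folklore] -/
theorem ofArithInput_V (A : ArithInput E l) [NeZero l] :
    (ofArithInput E l A).V = VSection E (TorsionField E l) := rfl

/-- Hence: arithmetic input ⟹ Joshi's Initial Theta Data EXIST (for `K = F(E_F[l])`, `F̄ = AlgebraicClosure F`). PROVED.
[claim: Joshi2024ATS3, status: disputed] -/
theorem nonempty_of_arithInput (A : ArithInput E l) [NeZero l] :
    Nonempty (InitialThetaData F (TorsionField E l) (AlgebraicClosure F) E l) :=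
  ⟨ofArithInput E l A⟩

/-- The same datum ALSO underlies Mochizuki-side initial Θ-data whenever the `π₁`-geometric interface is supplied: the
dictionary map `ofMochizuki` of the tree's `InitialThetaData.ofArith E l A Pb geom …` has the same `V` as `ofArithInput E l A`
(both are `VSection`). PROVED (`rfl`). [claim: Mochizuki2012, status: disputed] -/
theorem ofMochizuki_ofArith_V (A : ArithInput E l) [NeZero l] (Pb : BadPlacePredicates (TorsionField E l))
    (geom : ThetaGeometry.{u} (AlgebraicClosure F ≃ₐ[F] AlgebraicClosure F)
      (galoisSubgroupOf F (TorsionField E l) (AlgebraicClosure F)) l)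
    (hbad_type : ∀ w : Val (TorsionField E l),
      toVMod F (TorsionField E l) E w ∈ Val.non '' A.VbadMod → Pb.IsTypeOneZModLPM w)
    (hbad_cusp : ∀ w : Val (TorsionField E l),
      toVMod F (TorsionField E l) E w ∈ Val.non '' A.VbadMod → Pb.IsCanonicalGeneratorCusp w) :
    (ofMochizuki (Literature.IUT.HodgeTheaters.InitialThetaData.ofArith E l A Pb geom hbad_type hbad_cusp)).V =
      (ofArithInput E l A).V := rfl

end OfArith

/-! ## At a point of the `λ`-line: [J-IV] Thm. 5.7.1's conclusion, unconditionally in the arithmetic -/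

section LambdaLine

variable (P : NFPoint)

-- (instance search for `Algebra F K`, `K = F(E_F[l])`, over the nested subtype field `F` needs a larger budget — as in
-- the tree's `exists_initialThetaData_of_conditions`)
set_option synthInstance.maxHeartbeats 200000 in
/-- **Joshi's Initial Theta Data EXIST at `λ`** ([J-IV] Thm. 5.7.1, conclusion «`C_λ` satisfies Initial Theta Data [J-III
§3.1, §3.3] … with the prime `ℓ`», p.53 l.44–45; [IUTchIV] Cor. 2.2 (ii) (P7)): for `λ` minimally presented in `U_P`, a prime
`l ≥ 7` with (P2) (`Cor22.CondP2`; Joshi's Lem. 5.8.7 (2)), (P5) (`Cor22.CondP5`; Lem. 5.8.9) and no `l`-cyclic subgroup scheme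
((P4); it yields (P6) = Lem. 5.8.11 via the tree's `imageContainsSL2_of_not_admitsLCyclic`), the structure
`ATS3.InitialThetaData (FTheta λ) (F(E_F[l])) (F̄) (ETheta λ) l` is INHABITED — `F = F_mod(√−1, W[2·3·5])`, `E_F = W ⊗ F`
(`FTheta`, `ETheta`). NO `π₁`-geometric hypothesis (contrast the tree's `exists_initialThetaData_of_conditions`). PROVED.
[claim: Joshi2024ATS4, status: disputed] [claim: Mochizuki2012, status: disputed] -/
theorem nonempty_at (hP : P ∈ UP) {l : ℕ} [NeZero l] (hl : l.Prime) (h7 : 7 ≤ l) (hP2 : Cor22.CondP2 P l)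
    (hP5 : Cor22.CondP5 P l) (hno : ¬ (thetaEllPt P).AdmitsLCyclic l) :
    Nonempty (InitialThetaData (FTheta P) (TorsionField (ETheta P) l) (AlgebraicClosure (FTheta P)) (ETheta P) l) :=
  nonempty_of_arithInput (ETheta P) l (arithInputAt P hP hl h7 hP2 hP5 hno)

set_option synthInstance.maxHeartbeats 200000 in
/-- **[J-IV] Thm. 5.7.1 / [IUTchIV] Cor. 2.2 (ii) shape, on a compactly bounded set**: for a compactly bounded `K_V` there is
`H_K ∈ ℝ` such that for every `λ ∈ K_V` minimally presented in `U_P` and every prime `l ≥ 7` with (P2), (P5) and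
`log(q^∀(λ)) > H_K` (so (P4) holds, the tree's `exists_HK_not_admitsLCyclic`; `NeZero l` is the number-field instance's
binder, implied by primality), Joshi's Initial Theta Data for
`(FTheta λ, ETheta λ, l)` EXIST. The `ℓ`-WINDOW of Thm. 5.7.1 / (C1) (which produces such `l`, Lem. 5.8.2–5.8.6) is E-t28's
`Thm571With`; this theorem is the «ITD» half, in the arithmetic reading, with no `π₁`-geometric input. PROVED.
[claim: Joshi2024ATS4, status: disputed] [claim: Mochizuki2012, status: disputed] -/
theorem exists_HK_nonempty (D : CBData) :
    ∃ HK : ℝ, ∀ P : NFPoint, D.Mem P → ∀ hP : P ∈ UP, ∀ l : ℕ, ∀ _ : NeZero l, l.Prime → 7 ≤ l →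
      Cor22.CondP2 P l → Cor22.CondP5 P l → HK < Cor22.logQForall P →
        Nonempty (InitialThetaData (FTheta P) (TorsionField (ETheta P) l) (AlgebraicClosure (FTheta P)) (ETheta P) l) := by
  obtain ⟨HK, hHK⟩ := exists_HK_not_admitsLCyclic D
  exact ⟨HK, fun P hPD hP l _ hl h7 hP2 hP5 hgt =>
    nonempty_at P hP hl h7 hP2 hP5 (hHK P hPD hP l hl h7 hP2 hgt)⟩

end LambdaLine

end Summit.ABC.IUTFork.Joshi.ATS3.InitialThetaData

end
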